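import Literature.AnabelianGeometry.EtaleTheta.SettingModelTateDeckDisplay
import Literature.AnabelianGeometry.EtaleTheta.Discharge.Sec2Remark2141Engine
import HarnessLib

/-!
# [EtTh] Remark 2.14.1 AT THE TATE DATUM OF RECORD, part 2a: the EXACT second-difference law of the
# `Gal(Y/X̲̲)`-translates of the étale theta class `η̈♯` — `η̈♯ · (x₀²·η̈♯) · (x₀·η̈♯)⁻² = κ(q̈)^{−2n²}`
# (proof-only companion over abc-iut-L2-t6's deck displays)

Mochizuki, *The Étale Theta Function and its Frobenioid-theoretic Manifestations* [EtTh], Publ. RIMS **45**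
(2009), §2 Remark 2.14.1 PRIMS PDF p. 51, proof of Prop. 2.14 (ii) p. 50 ("Since the action by an element of
`Gal(Y/X)` clearly maps `Ü²` to a `K^×`-multiple of `Ü²` …"), §1 Prop. 1.5 (iii) p. 23 ("`η̈^Θ ↦ η̈^Θ − 2a·log(Ü) −
(a²/2)·log(q_X) + log(O^×_K̈)`, `log(Ü) ↦ log(Ü) + a·log(q_X)/2 + log(O^×_K̈)`") (locators `p.N` = PDF pages; bib key
`MochizukiEtTh2009`) [cite: MochizukiEtTh2009, Rmk 2.14.1 p.51].  Cell `abc-iut`, layer L2 [EtTh], seat abc-iut-w6-d076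
(gen 5), row «RMK2141-NOGO@modelχq» (abc-iut-L2-lead R1137), part 2a (part 1 = `Sec2Remark2141Engine`: the generic
engine «a cocycle extension of `α_δ` to `Π^tp_X[μ_N]` forces the second difference of the translates to be a
coboundary»).  PROOF-ONLY over abc-iut-L2-t6's F7q deck displays at the stage-2 («Tate shear») model
`ThetaSetting.modelχq p 1 2` (`SettingModelTateDeckDisplay`: `conj_deckGen_zClassYddχq` — `σ₀·x′ = x′·log(Ü)⁻²·κ(q̈)⁻¹`,
`conj_deckGen_logUdd` — `σ₀·log(Ü) = log(Ü)·κ(q̈)`, both with unit `1`, `σ₀ = (a, 1)` the deck generator) and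
abc-iut-L2-t12's `KummerCore.conj_kumYdd_toKddHat` (`σ·κ(u) = κ(σ̄u)`): no definition, no instance, no notation, no
new named fact; everything consumed BY NAME.

PROVED (all at `D = ThetaSetting.modelχq p 1 2`, `x′ = zClassYddχq p 1 2` abc-iut-L2-t6's lift of `η̈♯ = etaDdχq` to
`H¹((Π^tp_Ÿ)^Θ, Δ_Θ)`, `L = log(Ü)`, `Q = κ(q̈)` the Kummer class of `q̈ = p`, `σ₀ = (a, 1)`):
* `conj_deckGen_pow_kumYdd_qddUnit` — `σ₀ⁿ·Q = Q` (`σ₀` is geometric: `aug σ₀ = 1` fixes `q̈`);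
* `conj_deckGen_pow_logUdd` — `σ₀ⁿ·L = L·Qⁿ` («`log(Ü) ↦ log(Ü) + a·log(q_X)/2`», `q_X = q̈²`);
* `conj_deckGen_pow_zClassYddχq` — **`σ₀ⁿ·x′ = x′·L^{−2n}·Q^{−n²}`** EXACTLY (no unit term: the printed
  `log(O^×_K̈)`-ambiguity of Prop. 1.5 (iii) is ABSENT along the powers of the deck generator at this model);
* `zClassYddχq_second_difference` — **`x′ · (σ₀^{2n}·x′) · (σ₀ⁿ·x′)⁻² = Q^{−2n²}`**: the second difference of the
  translates of the theta class along `Gal(Y/X)` is the Kummer class of `q̈^{−2n²}` — the `log(Ü)`-terms cancel and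
  only the «`K^×`-multiple» `q̈`-term of p. 50 survives.  With `n = l` (`x₀ = σ₀^l` generates `Gal(Y̲̲/X̲̲) ≅ l·ℤ`)
  this is the class that part 2b reduces mod `N` on `Π^tp_Ÿ̲̲` and shows NOT to be a coboundary for `N ∤ 2l`
  (`p^{2l} ∉ ℚ_p^{×N}`), contradicting the engine of part 1 — i.e. Remark 2.14.1 at the datum of record.
HONEST LABEL: `modelχq` is a SEMI-SYNTHETIC model of the typed §1 interface (the Tate-sheared χ-twisted root; not the
tempered `π₁` of a curve) — consistency evidence and the kernel record of the printed computation at that inhabitant;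
nothing of [EtTh] (refereed) is asserted or disputed; no side is taken on [IUTchIII] Cor. 3.12; typed ≠ proved.
-/

noncomputable section

namespace Literature.AnabelianGeometry.EtaleTheta.SettingModel

open Literature.AnabelianGeometry.SemiGraphs _root_.Topology _root_.Function

variable (p : ℕ) [Fact p.Prime]

/-- The deck generator `σ₀ = (a, 1)` and its powers are GEOMETRIC: `aug(σ₀ⁿ) = 1`.
[cite: MochizukiEtTh2009, Prop 1.5 (iii) p.23] -/
theorem aug_deckGen_pow (n : ℕ) :
    (ThetaSetting.modelχq p 1 2 even_two).aug
      ((SemidirectProduct.inl (gfpOf (FreeGroup.of 0)) : PiTpχq p 1 2) ^ n) = 1 := by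
  rw [map_pow]
  have h1 : (ThetaSetting.modelχq p 1 2 even_two).aug
      (SemidirectProduct.inl (gfpOf (FreeGroup.of 0)) : PiTpχq p 1 2) = 1 := by
    show (SemidirectProduct.inl (gfpOf (FreeGroup.of 0)) : PiTpχq p 1 2).right = 1
    exact SemidirectProduct.right_inl _
  rw [h1, one_pow]

/-- **`σ₀ⁿ·κ(q̈) = κ(q̈)`**: the powers of the deck generator fix the Kummer class of `q̈` (they act on `ℚ̄_p^×`
through `aug(σ₀ⁿ) = 1`; abc-iut-L2-t12's `conj_kumYdd_toKddHat`). [cite: MochizukiEtTh2009, Prop 1.5 (iii) p.23] -/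
theorem conj_deckGen_pow_kumYdd_qddUnit (hC : (ThetaSetting.modelχq p 1 2 even_two).Compat) (n : ℕ) :
    haveI := hC.GtpYddTheta_normal
    ContH1.conj (MonoidHom.id (ThetaSetting.modelχq p 1 2 even_two).GtpTheta)
        (ThetaSetting.modelχq p 1 2 even_two).DeltaTheta
        ((ThetaSetting.modelχq p 1 2 even_two).toTheta
          ((SemidirectProduct.inl (gfpOf (FreeGroup.of 0)) : PiTpχq p 1 2) ^ n))
        ((kummerCoreχq p 1 2 even_two).toKummerData.kumYdd
          ((kummerCoreχq p 1 2 even_two).toKummerData.toKddHat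
            (ThetaSetting.modelχq p 1 2 even_two).qddUnit)) =
      (kummerCoreχq p 1 2 even_two).toKummerData.kumYdd
        ((kummerCoreχq p 1 2 even_two).toKummerData.toKddHat
          (ThetaSetting.modelχq p 1 2 even_two).qddUnit) := by
  refine (kummerCoreχq p 1 2 even_two).conj_kumYdd_toKddHat hC _ _ _ ?_
  rw [aug_deckGen_pow, one_smul]

/-- **`σ₀ⁿ·log(Ü) = log(Ü)·κ(q̈)ⁿ`** («`log(Ü) ↦ log(Ü) + a·log(q_X)/2 + log(O^×_K̈)`», `q_X = q̈²`; iterate of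
abc-iut-L2-t6's `conj_deckGen_logUdd`, unit `1`). [cite: MochizukiEtTh2009, Prop 1.5 (iii) p.23] -/
theorem conj_deckGen_pow_logUdd (hC : (ThetaSetting.modelχq p 1 2 even_two).Compat) (n : ℕ) :
    haveI := hC.GtpYddTheta_normal
    ContH1.conj (MonoidHom.id (ThetaSetting.modelχq p 1 2 even_two).GtpTheta)
        (ThetaSetting.modelχq p 1 2 even_two).DeltaTheta
        ((ThetaSetting.modelχq p 1 2 even_two).toTheta
          ((SemidirectProduct.inl (gfpOf (FreeGroup.of 0)) : PiTpχq p 1 2) ^ n))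
        (kummerCoreχq p 1 2 even_two).logUdd =
      (kummerCoreχq p 1 2 even_two).logUdd *
        (kummerCoreχq p 1 2 even_two).toKummerData.kumYdd
          ((kummerCoreχq p 1 2 even_two).toKummerData.toKddHat
            (ThetaSetting.modelχq p 1 2 even_two).qddUnit) ^ n := by
  haveI := hC.GtpYddTheta_normal
  induction n with
  | zero => rw [pow_zero, pow_zero, map_one, ContH1.conj_one_apply, mul_one]
  | succ n ih =>
    rw [pow_succ, map_mul, ContH1.conj_mul_apply, conj_deckGen_logUdd p 1 hC, map_one, map_one, mul_one, map_mul,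
      ih, conj_deckGen_pow_kumYdd_qddUnit p hC n, pow_succ, mul_assoc]

/-- **`σ₀ⁿ·x′ = x′·log(Ü)^{−2n}·κ(q̈)^{−n²}` EXACTLY** — the printed `Z`-action of Prop. 1.5 (iii)
("`η̈^Θ ↦ η̈^Θ − 2a·log(Ü) − (a²/2)·log(q_X)`", `(a²/2)·log(q_X) = a²·log(q̈)`) along the powers of the deck generator
at the Tate datum, WITHOUT unit term (induction over abc-iut-L2-t6's `conj_deckGen_zClassYddχq` / `conj_deckGen_logUdd`).
[cite: MochizukiEtTh2009, Prop 1.5 (iii) p.23] -/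
theorem conj_deckGen_pow_zClassYddχq (hC : (ThetaSetting.modelχq p 1 2 even_two).Compat) (n : ℕ) :
    haveI := hC.GtpYddTheta_normal
    ContH1.conj (MonoidHom.id (ThetaSetting.modelχq p 1 2 even_two).GtpTheta)
        (ThetaSetting.modelχq p 1 2 even_two).DeltaTheta
        ((ThetaSetting.modelχq p 1 2 even_two).toTheta
          ((SemidirectProduct.inl (gfpOf (FreeGroup.of 0)) : PiTpχq p 1 2) ^ n))
        (zClassYddχq p 1 2 even_two) =
      zClassYddχq p 1 2 even_two * (kummerCoreχq p 1 2 even_two).logUdd ^ (-(2 * (n : ℤ))) *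
        (kummerCoreχq p 1 2 even_two).toKummerData.kumYdd
          ((kummerCoreχq p 1 2 even_two).toKummerData.toKddHat
            (ThetaSetting.modelχq p 1 2 even_two).qddUnit) ^ (-((n : ℤ) ^ 2)) := by
  haveI := hC.GtpYddTheta_normal
  induction n with
  | zero =>
    rw [pow_zero, map_one, ContH1.conj_one_apply]
    simp
  | succ n ih =>
    rw [pow_succ, map_mul, ContH1.conj_mul_apply, conj_deckGen_zClassYddχq p 2 even_two hC, map_one, map_one,
      mul_one, map_mul, map_mul, map_zpow, map_zpow, ih, conj_deckGen_pow_logUdd p hC n,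
      conj_deckGen_pow_kumYdd_qddUnit p hC n]
    apply (Additive.ofMul : (ThetaSetting.modelχq p 1 2 even_two).H1Theta
      ((ThetaSetting.modelχq p 1 2 even_two).GtpYdd.map (ThetaSetting.modelχq p 1 2 even_two).toTheta) ≃ _).injective
    simp only [ofMul_mul, ofMul_zpow, ofMul_pow, smul_add]
    push_cast
    module

/-- **The second difference of the `Gal(Y/X)`-translates of the theta class is the Kummer class of `q̈^{−2n²}`**:
`x′ · (σ₀^{2n}·x′) · (σ₀ⁿ·x′)⁻² = κ(q̈)^{−2n²}` in `H¹((Π^tp_Ÿ)^Θ, Δ_Θ)` at the Tate datum — the `log(Ü)`-terms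
cancel, the «`K^×`-multiple» of p. 50 survives.  For `n = l` (`x₀ = σ₀^l` a generator of `Gal(Y̲̲/X̲̲) ≅ l·ℤ`) this is the
obstruction class of Remark 2.14.1. [cite: MochizukiEtTh2009, Rmk 2.14.1 p.51] -/
theorem zClassYddχq_second_difference (hC : (ThetaSetting.modelχq p 1 2 even_two).Compat) (n : ℕ) :
    haveI := hC.GtpYddTheta_normal
    zClassYddχq p 1 2 even_two *
        ContH1.conj (MonoidHom.id (ThetaSetting.modelχq p 1 2 even_two).GtpTheta)
          (ThetaSetting.modelχq p 1 2 even_two).DeltaTheta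
          ((ThetaSetting.modelχq p 1 2 even_two).toTheta
            ((SemidirectProduct.inl (gfpOf (FreeGroup.of 0)) : PiTpχq p 1 2) ^ (2 * n)))
          (zClassYddχq p 1 2 even_two) *
        (ContH1.conj (MonoidHom.id (ThetaSetting.modelχq p 1 2 even_two).GtpTheta)
          (ThetaSetting.modelχq p 1 2 even_two).DeltaTheta
          ((ThetaSetting.modelχq p 1 2 even_two).toTheta
            ((SemidirectProduct.inl (gfpOf (FreeGroup.of 0)) : PiTpχq p 1 2) ^ n))
          (zClassYddχq p 1 2 even_two)) ^ (-(2 : ℤ)) =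
      (kummerCoreχq p 1 2 even_two).toKummerData.kumYdd
          ((kummerCoreχq p 1 2 even_two).toKummerData.toKddHat
            (ThetaSetting.modelχq p 1 2 even_two).qddUnit) ^ (-(2 * (n : ℤ) ^ 2)) := by
  haveI := hC.GtpYddTheta_normal
  rw [conj_deckGen_pow_zClassYddχq p hC (2 * n), conj_deckGen_pow_zClassYddχq p hC n]
  apply (Additive.ofMul : (ThetaSetting.modelχq p 1 2 even_two).H1Theta
    ((ThetaSetting.modelχq p 1 2 even_two).GtpYdd.map (ThetaSetting.modelχq p 1 2 even_two).toTheta) ≃ _).injective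
  simp only [ofMul_mul, ofMul_zpow, smul_add, smul_smul]
  push_cast
  module

end Literature.AnabelianGeometry.EtaleTheta.SettingModel

end
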